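import Mathlib
import Summits.Ventures.PercRepro2.HCov
import Summits.Ventures.PercRepro2.HCovCubic
import Summits.Ventures.PercRepro2.TriDisagreement
import Summits.Ventures.PercRepro2.TriDisagreementPinned
import Summits.Ventures.PercRepro2.TypedSplit
import Summits.Ventures.PercRepro2.OneTypedEdge
import Summits.Ventures.PercRepro2.TypedSeries
import Summits.Ventures.PercRepro2.StarPattern
import Summits.Ventures.PercRepro2.StarIdentities
import Summits.Ventures.PercRepro2.StarDebt
import Summits.Ventures.PercRepro2.ChainCoeff
import Summits.Ventures.PercRepro2.StarChain
import Summits.Ventures.PercRepro2.StarPayment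
import Summits.Ventures.PercRepro2.StarTwin

/-!
# The triangle base is a typed count of the twin-star graph (blind cell PercRepro2, p1 g12; the
graph-row reading of `B(△₁)`, part II)

`y` and `y'` are twin unmarked vertices on the neighbours `u₁ u₂ u₃` (`TwinStar`). Pin `s₃` and
`t₁` OPEN and type `s₂`, `t₂`, `t₃` (type `1`): through `y` the pair `12` is a series pair, through
`y'` the pairs `01` and `02` are — three independent type-`1` pairs, the triangle. For each of the
27 placements the state of the configuration equals the state of `y` alone carrying the merged
block (**`st_twin_merge`**: pendant singletons closed with `st_update_false_pendant`, `y'`-edges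
moved to `y` through a shared open neighbour with `conn_move_twin`), so the typed count of the
twin-star graph on this minor is the triangle base of `y`'s star:

`B(△₁) = N(G⁺; s₃, t₁ open; s₂, t₂, t₃ of type 1)`  (**`Btriangle_eq_typedCount_twin`**).

Hence `TvT` (`B(T₁) ≤ B(△₁)`) is an inequality between typed counts of GRAPHS (**`tvT_iff_twin`**;
with `Bone_T_eq_graph` also `B(T₁)` is one) — no hyperedge. Identities only.
-/

namespace Summit.Ventures.PercRepro2

open CovForm CovForm.OneTyped CovForm.TypedRed

namespace StarPattern

section Merge

variable {V : Type*} {E : Type*} [DecidableEq E] {ends : E → Sym2 V} {o a₁ a₂ a₃ b : V}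
  {s₁ s₂ s₃ t₁ t₂ t₃ : E} {y y' u₁ u₂ u₃ : V}

/-- The closure condition at `y'` for the non-star edges of a `cfg`. -/
lemma cfg_closed_y' (W : TwinStar ends o a₁ a₂ a₃ b s₁ s₂ s₃ t₁ t₂ t₃ y y' u₁ u₂ u₃) {x : Config E}
  (hx : TwinClosed ends s₁ s₂ s₃ t₁ t₂ t₃ y y' x) (p₁ p₂ p₃ q₁ q₂ q₃ : Bool) :
    ∀ g, g ≠ t₁ → g ≠ t₂ → g ≠ t₃ → y' ∈ ends g →
      (ends g).IsDiag ∨ cfg s₁ s₂ s₃ t₁ t₂ t₃ x p₁ p₂ p₃ q₁ q₂ q₃ g = false := by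
  intro g h4 h5 h6 hyg
  obtain ⟨n1, n2, n3⟩ := W.y'_not_mem_s
  have h1 : g ≠ s₁ := fun h => n1 (h ▸ hyg)
  have h2 : g ≠ s₂ := fun h => n2 (h ▸ hyg)
  have h3 : g ≠ s₃ := fun h => n3 (h ▸ hyg)
  rw [cfg_other x p₁ p₂ p₃ q₁ q₂ q₃ h1 h2 h3 h4 h5 h6]
  exact hx.2 g h4 h5 h6 hyg

/-- The closure condition at `y` for the non-star edges of a `cfg`. -/
lemma cfg_closed_y (W : TwinStar ends o a₁ a₂ a₃ b s₁ s₂ s₃ t₁ t₂ t₃ y y' u₁ u₂ u₃) {x : Config E}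
  (hx : TwinClosed ends s₁ s₂ s₃ t₁ t₂ t₃ y y' x) (p₁ p₂ p₃ q₁ q₂ q₃ : Bool) :
    ∀ g, g ≠ s₁ → g ≠ s₂ → g ≠ s₃ → y ∈ ends g →
      (ends g).IsDiag ∨ cfg s₁ s₂ s₃ t₁ t₂ t₃ x p₁ p₂ p₃ q₁ q₂ q₃ g = false := by
  intro g h1 h2 h3 hyg
  obtain ⟨n1, n2, n3⟩ := W.y_not_mem_t
  have h4 : g ≠ t₁ := fun h => n1 (h ▸ hyg)
  have h5 : g ≠ t₂ := fun h => n2 (h ▸ hyg)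
  have h6 : g ≠ t₃ := fun h => n3 (h ▸ hyg)
  rw [cfg_other x p₁ p₂ p₃ q₁ q₂ q₃ h1 h2 h3 h4 h5 h6]
  exact hx.1 g h1 h2 h3 hyg

/-- Closing the pendant `t₁` at `y'`. -/
lemma st_close_t₁ (W : TwinStar ends o a₁ a₂ a₃ b s₁ s₂ s₃ t₁ t₂ t₃ y y' u₁ u₂ u₃) {x : Config E}
  (hx : TwinClosed ends s₁ s₂ s₃ t₁ t₂ t₃ y y' x) (p₁ p₂ p₃ : Bool) :
    st ends o a₁ a₂ a₃ b (cfg s₁ s₂ s₃ t₁ t₂ t₃ x p₁ p₂ p₃ true false false) = st ends o a₁ a₂ a₃ b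
      (cfg s₁ s₂ s₃ t₁ t₂ t₃ x p₁ p₂ p₃ false false false) := by
  rw [← update_cfg_t₁ W.T x p₁ p₂ p₃ true false false false]
  refine st_update_false_pendant ends o a₁ a₂ a₃ b W.ht₁ W.hy'u₁ ?_ W.hy'o W.hy'1 W.hy'2 W.hy'3
    W.hy'b
  intro g hg hyg
  by_cases h5 : g = t₂
  · subst h5; right; exact cfg_t₂ W.T x _ _ _ _ _ _
  by_cases h6 : g = t₃
  · subst h6; right; exact cfg_t₃ x _ _ _ _ _ _
  exact cfg_closed_y' W hx p₁ p₂ p₃ true false false g hg h5 h6 hyg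

/-- Closing the pendant `t₂` at `y'`. -/
lemma st_close_t₂ (W : TwinStar ends o a₁ a₂ a₃ b s₁ s₂ s₃ t₁ t₂ t₃ y y' u₁ u₂ u₃) {x : Config E}
  (hx : TwinClosed ends s₁ s₂ s₃ t₁ t₂ t₃ y y' x) (p₁ p₂ p₃ : Bool) :
    st ends o a₁ a₂ a₃ b (cfg s₁ s₂ s₃ t₁ t₂ t₃ x p₁ p₂ p₃ false true false) = st ends o a₁ a₂ a₃ b
      (cfg s₁ s₂ s₃ t₁ t₂ t₃ x p₁ p₂ p₃ false false false) := by
  rw [← update_cfg_t₂ W.T x p₁ p₂ p₃ false true false false]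
  refine st_update_false_pendant ends o a₁ a₂ a₃ b W.ht₂ W.hy'u₂ ?_ W.hy'o W.hy'1 W.hy'2 W.hy'3
    W.hy'b
  intro g hg hyg
  by_cases h4 : g = t₁
  · subst h4; right; exact cfg_t₁ W.T x _ _ _ _ _ _
  by_cases h6 : g = t₃
  · subst h6; right; exact cfg_t₃ x _ _ _ _ _ _
  exact cfg_closed_y' W hx p₁ p₂ p₃ false true false g h4 hg h6 hyg

/-- Closing the pendant `t₃` at `y'`. -/
lemma st_close_t₃ (W : TwinStar ends o a₁ a₂ a₃ b s₁ s₂ s₃ t₁ t₂ t₃ y y' u₁ u₂ u₃) {x : Config E}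
  (hx : TwinClosed ends s₁ s₂ s₃ t₁ t₂ t₃ y y' x) (p₁ p₂ p₃ : Bool) :
    st ends o a₁ a₂ a₃ b (cfg s₁ s₂ s₃ t₁ t₂ t₃ x p₁ p₂ p₃ false false true) = st ends o a₁ a₂ a₃ b
      (cfg s₁ s₂ s₃ t₁ t₂ t₃ x p₁ p₂ p₃ false false false) := by
  rw [← update_cfg_t₃ x p₁ p₂ p₃ false false true false]
  refine st_update_false_pendant ends o a₁ a₂ a₃ b W.ht₃ W.hy'u₃ ?_ W.hy'o W.hy'1 W.hy'2 W.hy'3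
    W.hy'b
  intro g hg hyg
  by_cases h4 : g = t₁
  · subst h4; right; exact cfg_t₁ W.T x _ _ _ _ _ _
  by_cases h5 : g = t₂
  · subst h5; right; exact cfg_t₂ W.T x _ _ _ _ _ _
  exact cfg_closed_y' W hx p₁ p₂ p₃ false false true g h4 h5 hg hyg

/-- Closing (or opening) the pendant `s₁` at `y`. -/
lemma st_close_s₁ (W : TwinStar ends o a₁ a₂ a₃ b s₁ s₂ s₃ t₁ t₂ t₃ y y' u₁ u₂ u₃) {x : Config E}
  (hx : TwinClosed ends s₁ s₂ s₃ t₁ t₂ t₃ y y' x) (q₁ q₂ q₃ : Bool) :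
    st ends o a₁ a₂ a₃ b (cfg s₁ s₂ s₃ t₁ t₂ t₃ x true false false q₁ q₂ q₃) = st ends o a₁ a₂ a₃ b
      (cfg s₁ s₂ s₃ t₁ t₂ t₃ x false false false q₁ q₂ q₃) := by
  rw [← update_cfg_s₁ W.T x true false false q₁ q₂ q₃ false]
  refine st_update_false_pendant ends o a₁ a₂ a₃ b W.hs₁ W.hyu₁ ?_ W.hyo W.hy1 W.hy2 W.hy3 W.hyb
  intro g hg hyg
  by_cases h2 : g = s₂
  · subst h2; right; exact cfg_s₂ W.T x _ _ _ _ _ _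
  by_cases h3 : g = s₃
  · subst h3; right; exact cfg_s₃ W.T x _ _ _ _ _ _
  exact cfg_closed_y W hx true false false q₁ q₂ q₃ g hg h2 h3 hyg

/-- Closing the pendant `s₃` at `y`. -/
lemma st_close_s₃ (W : TwinStar ends o a₁ a₂ a₃ b s₁ s₂ s₃ t₁ t₂ t₃ y y' u₁ u₂ u₃) {x : Config E}
  (hx : TwinClosed ends s₁ s₂ s₃ t₁ t₂ t₃ y y' x) (q₁ q₂ q₃ : Bool) :
    st ends o a₁ a₂ a₃ b (cfg s₁ s₂ s₃ t₁ t₂ t₃ x false false true q₁ q₂ q₃) = st ends o a₁ a₂ a₃ b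
      (cfg s₁ s₂ s₃ t₁ t₂ t₃ x false false false q₁ q₂ q₃) := by
  rw [← update_cfg_s₃ W.T x false false true q₁ q₂ q₃ false]
  refine st_update_false_pendant ends o a₁ a₂ a₃ b W.hs₃ W.hyu₃ ?_ W.hyo W.hy1 W.hy2 W.hy3 W.hyb
  intro g hg hyg
  by_cases h1 : g = s₁
  · subst h1; right; exact cfg_s₁ W.T x _ _ _ _ _ _
  by_cases h2 : g = s₂
  · subst h2; right; exact cfg_s₂ W.T x _ _ _ _ _ _
  exact cfg_closed_y W hx false false true q₁ q₂ q₃ g h1 h2 hg hyg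

/-- Moving `t₁` to `s₁` through the shared open neighbour `u₂`. -/
lemma st_move_t₁_via_₂ (W : TwinStar ends o a₁ a₂ a₃ b s₁ s₂ s₃ t₁ t₂ t₃ y y' u₁ u₂ u₃) (x : Config
  E) (p₁ p₃ q₃ : Bool) :
    st ends o a₁ a₂ a₃ b (cfg s₁ s₂ s₃ t₁ t₂ t₃ x p₁ true p₃ true true q₃) = st ends o a₁ a₂ a₃ b
      (cfg s₁ s₂ s₃ t₁ t₂ t₃ x true true p₃ false true q₃) := by
  refine st_congr_of_conn fun a b => ?_
  rw [conn_move_twin W.hs₂ W.ht₂ W.hs₁ W.ht₁ W.T.h12.symm W.T.c21 W.T.c12.symm W.T.g12.symm W.T.c11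
    (cfg_s₂ W.T x _ _ _ _ _ _) (cfg_t₂ W.T x _ _ _ _ _ _) (cfg_t₁ W.T x _ _ _ _ _ _) a b,
    update_cfg_s₁ W.T, update_cfg_t₁ W.T]

/-- Moving `t₁` to `s₁` through the shared open neighbour `u₃`. -/
lemma st_move_t₁_via_₃ (W : TwinStar ends o a₁ a₂ a₃ b s₁ s₂ s₃ t₁ t₂ t₃ y y' u₁ u₂ u₃) (x : Config
  E) (p₁ p₂ q₂ : Bool) :
    st ends o a₁ a₂ a₃ b (cfg s₁ s₂ s₃ t₁ t₂ t₃ x p₁ p₂ true true q₂ true) = st ends o a₁ a₂ a₃ b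
      (cfg s₁ s₂ s₃ t₁ t₂ t₃ x true p₂ true false q₂ true) := by
  refine st_congr_of_conn fun a b => ?_
  rw [conn_move_twin W.hs₃ W.ht₃ W.hs₁ W.ht₁ W.T.h13.symm W.T.c31 W.T.c13.symm W.T.g13.symm W.T.c11
    (cfg_s₃ W.T x _ _ _ _ _ _) (cfg_t₃ x _ _ _ _ _ _) (cfg_t₁ W.T x _ _ _ _ _ _) a b,
    update_cfg_s₁ W.T, update_cfg_t₁ W.T]

/-- Moving `t₂` to `s₂` through the shared open neighbour `u₁`. -/
lemma st_move_t₂_via_₁ (W : TwinStar ends o a₁ a₂ a₃ b s₁ s₂ s₃ t₁ t₂ t₃ y y' u₁ u₂ u₃) (x : Config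
  E) (p₂ p₃ q₃ : Bool) :
    st ends o a₁ a₂ a₃ b (cfg s₁ s₂ s₃ t₁ t₂ t₃ x true p₂ p₃ true true q₃) = st ends o a₁ a₂ a₃ b
      (cfg s₁ s₂ s₃ t₁ t₂ t₃ x true true p₃ true false q₃) := by
  refine st_congr_of_conn fun a b => ?_
  rw [conn_move_twin W.hs₁ W.ht₁ W.hs₂ W.ht₂ W.T.h12 W.T.c12 W.T.c21.symm W.T.g12 W.T.c22
    (cfg_s₁ W.T x _ _ _ _ _ _) (cfg_t₁ W.T x _ _ _ _ _ _) (cfg_t₂ W.T x _ _ _ _ _ _) a b,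
    update_cfg_s₂ W.T, update_cfg_t₂ W.T]

/-- Moving `t₂` to `s₂` through the shared open neighbour `u₃`. -/
lemma st_move_t₂_via_₃ (W : TwinStar ends o a₁ a₂ a₃ b s₁ s₂ s₃ t₁ t₂ t₃ y y' u₁ u₂ u₃) (x : Config
  E) (p₂ p₁ q₁ : Bool) :
    st ends o a₁ a₂ a₃ b (cfg s₁ s₂ s₃ t₁ t₂ t₃ x p₁ p₂ true q₁ true true) = st ends o a₁ a₂ a₃ b
      (cfg s₁ s₂ s₃ t₁ t₂ t₃ x p₁ true true q₁ false true) := by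
  refine st_congr_of_conn fun a b => ?_
  rw [conn_move_twin W.hs₃ W.ht₃ W.hs₂ W.ht₂ W.T.h23.symm W.T.c32 W.T.c23.symm W.T.g23.symm W.T.c22
    (cfg_s₃ W.T x _ _ _ _ _ _) (cfg_t₃ x _ _ _ _ _ _) (cfg_t₂ W.T x _ _ _ _ _ _) a b,
    update_cfg_s₂ W.T, update_cfg_t₂ W.T]

/-- **The merge**: with `s₃`, `t₁` open and `s₂`, `t₂`, `t₃` placed as `a`, `a'`, `a''`, the state
is that of `y` alone carrying the union of the pairs placed: `12` if `a`, `01` if `a'`, `02` if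
`a''` (the `onCopy` / `orU` pattern of `Bindep3`). -/
theorem st_twin_merge (W : TwinStar ends o a₁ a₂ a₃ b s₁ s₂ s₃ t₁ t₂ t₃ y y' u₁ u₂ u₃) {x : Config
  E} (hx : TwinClosed ends s₁ s₂ s₃ t₁ t₂ t₃ y y' x) (hx₁ : x t₁ = false)
    (hx₂ : x t₂ = false) (hx₃ : x t₃ = false) (a a' a'' : Bool) :
    st ends o a₁ a₂ a₃ b (cfg s₁ s₂ s₃ t₁ t₂ t₃ x false a true true a' a'') =
      st ends o a₁ a₂ a₃ b (starSet s₁ s₂ s₃ (orU (onCopy (true, true, false) a')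
        (orU (onCopy (true, false, true) a'') (onCopy (false, true, true) a))) x) := by
  cases a <;> cases a' <;> cases a''
  · show _ = st ends o a₁ a₂ a₃ b (starSet s₁ s₂ s₃ (false, false, false) x)
    rw [← cfg_eq_starSet W.T hx₁ hx₂ hx₃, st_close_t₁ W hx, st_close_s₃ W hx]
  · show _ = st ends o a₁ a₂ a₃ b (starSet s₁ s₂ s₃ (true, false, true) x)
    rw [← cfg_eq_starSet W.T hx₁ hx₂ hx₃, st_move_t₁_via_₃ W x, st_close_t₃ W hx]
  · show _ = st ends o a₁ a₂ a₃ b (starSet s₁ s₂ s₃ (true, true, false) x)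
    rw [← cfg_eq_starSet W.T hx₁ hx₂ hx₃, st_close_s₃ W hx, ← st_close_s₁ W hx,
      st_move_t₂_via_₁ W x, st_close_t₁ W hx]
  · show _ = st ends o a₁ a₂ a₃ b (starSet s₁ s₂ s₃ (true, true, true) x)
    rw [← cfg_eq_starSet W.T hx₁ hx₂ hx₃, st_move_t₁_via_₃ W x, st_move_t₂_via_₃ W x,
      st_close_t₃ W hx]
  · show _ = st ends o a₁ a₂ a₃ b (starSet s₁ s₂ s₃ (false, true, true) x)
    rw [← cfg_eq_starSet W.T hx₁ hx₂ hx₃, st_close_t₁ W hx]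
  · show _ = st ends o a₁ a₂ a₃ b (starSet s₁ s₂ s₃ (true, true, true) x)
    rw [← cfg_eq_starSet W.T hx₁ hx₂ hx₃, st_move_t₁_via_₃ W x, st_close_t₃ W hx]
  · show _ = st ends o a₁ a₂ a₃ b (starSet s₁ s₂ s₃ (true, true, true) x)
    rw [← cfg_eq_starSet W.T hx₁ hx₂ hx₃, st_move_t₁_via_₂ W x, st_close_t₂ W hx]
  · show _ = st ends o a₁ a₂ a₃ b (starSet s₁ s₂ s₃ (true, true, true) x)
    rw [← cfg_eq_starSet W.T hx₁ hx₂ hx₃, st_move_t₁_via_₃ W x, st_move_t₂_via_₃ W x,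
      st_close_t₃ W hx]

end Merge

section Count

variable {V : Type*} {E : Type*} [Fintype E] [DecidableEq E] {R : Type*} [Field R]
  {ends : E → Sym2 V} {o a₁ a₂ a₃ b : V} {s₁ s₂ s₃ t₁ t₂ t₃ : E} {y y' u₁ u₂ u₃ : V}
  {F₀ : Finset E} {z₀ : Config E}

omit [Fintype E] in
/-- The kernel configuration of a placement term is a `cfg`. -/
lemma updates_eq_cfg (T : TwinEdges s₁ s₂ s₃ t₁ t₂ t₃) {x : Config E} (hx₁ : x s₁ = false)
    (a a' a'' : Bool) :
    Function.update (Function.update (Function.update (Function.update (Function.update x t₁ true)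
      s₃ true) t₃ a'') t₂ a') s₂ a = cfg s₁ s₂ s₃ t₁ t₂ t₃ x false a true true a' a'' := by
  funext g
  rw [cfg_apply]
  simp only [Function.update_apply]
  obtain ⟨h12, h13, h23, g12, g13, g23, c11, c12, c13, c21, c22, c23, c31, c32, c33⟩ := T
  split_ifs <;> simp_all

/-- One placement term of the twin typed count is a pattern count of `y`'s star. -/
lemma twin_term_eq_patCount (W : TwinStar ends o a₁ a₂ a₃ b s₁ s₂ s₃ t₁ t₂ t₃ y y' u₁ u₂ u₃)
    (D : StarData ends o a₁ a₂ a₃ b s₁ s₂ s₃ y u₁ u₂ u₃ F₀ z₀)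
    (D' : StarData ends o a₁ a₂ a₃ b t₁ t₂ t₃ y' u₁ u₂ u₃ F₀ z₀) (τ : E → ℕ)
    (hz₁ : z₀ s₁ = false) (hz₂ : z₀ s₂ = false) (hz₃ : z₀ s₃ = false) (hw₁ : z₀ t₁ = false)
    (hw₂ : z₀ t₂ = false) (hw₃ : z₀ t₃ = false) (a b' c a' b'' c' a'' b''' c'' : Bool) :
    typedCount F₀
        (Function.update (Function.update (Function.update (Function.update (Function.update z₀ s₃
          true) t₁ true) s₂ false) t₂ false) t₃ false)
        (Function.update (Function.update (Function.update τ t₃ 1) t₂ 1) s₂ 1)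
        (fun x y w => (K3 ends o a₁ a₂ a₃ b : Config E → Config E → Config E → R)
          (Function.update (Function.update (Function.update x t₃ a'') t₂ a') s₂ a)
          (Function.update (Function.update (Function.update y t₃ b''') t₂ b'') s₂ b')
          (Function.update (Function.update (Function.update w t₃ c'') t₂ c') s₂ c)) =
      patCount ends o a₁ a₂ a₃ b s₁ s₂ s₃ F₀ z₀ τ
        (orU (onCopy (true, true, false) a') (orU (onCopy (true, false, true) a'')
          (onCopy (false, true, true) a)))
        (orU (onCopy (true, true, false) b'') (orU (onCopy (true, false, true) b''')
          (onCopy (false, true, true) b')))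
        (orU (onCopy (true, true, false) c') (orU (onCopy (true, false, true) c'')
          (onCopy (false, true, true) c))) := by
  rw [typedCount_congr_τ F₀ _ (τ' := τ) (fun e he => by
    rw [Function.update_of_ne (ne_of_mem_of_not_mem he D.hF₂),
      Function.update_of_ne (ne_of_mem_of_not_mem he D'.hF₂),
      Function.update_of_ne (ne_of_mem_of_not_mem he D'.hF₃)])]
  rw [typedCount_repin_false F₀ s₃ D.hF₃]
  have e₃ : Function.update (Function.update (Function.update (Function.update (Function.update z₀
      s₃ true) t₁ true) s₂ false) t₂ false) t₃ false s₃ = true := by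
    rw [Function.update_of_ne W.T.c33, Function.update_of_ne W.T.c32,
      Function.update_of_ne W.T.h23.symm, Function.update_of_ne W.T.c31, Function.update_self]
  rw [e₃, typedCount_repin_false F₀ t₁ D'.hF₁]
  have e₁ : Function.update (Function.update (Function.update (Function.update (Function.update
      (Function.update z₀ s₃ true) t₁ true) s₂ false) t₂ false) t₃ false) s₃ false t₁ = true := by
    rw [Function.update_of_ne W.T.c31.symm, Function.update_of_ne W.T.g13,
      Function.update_of_ne W.T.g12, Function.update_of_ne W.T.c21.symm, Function.update_self]
  rw [e₁]
  have hz : Function.update (Function.update (Function.update (Function.update (Function.update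
      (Function.update (Function.update z₀ s₃ true) t₁ true) s₂ false) t₂ false) t₃ false) s₃
      false) t₁ false = z₀ := by
    funext g
    simp only [Function.update_apply]
    split_ifs <;> simp_all
  rw [hz]
  unfold patCount patKernel
  refine typedCount_congr_on F₀ z₀ τ fun x₁ x₂ x₃ hpin _ => ?_
  have hcl : ∀ v : Config E, (∀ e, e ∉ F₀ → v e = z₀ e) →
      TwinClosed ends s₁ s₂ s₃ t₁ t₂ t₃ y y' v := fun v hv =>
    ⟨D.closed_at hv, D'.closed_at hv⟩
  rw [K3_eq_KB, K3_eq_KB,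
    updates_eq_cfg W.T ((hpin s₁ D.hF₁).1.trans hz₁),
    updates_eq_cfg W.T ((hpin s₁ D.hF₁).2.1.trans hz₁),
    updates_eq_cfg W.T ((hpin s₁ D.hF₁).2.2.trans hz₁),
    st_twin_merge W (hcl x₁ fun e he => (hpin e he).1) ((hpin t₁ D'.hF₁).1.trans hw₁)
      ((hpin t₂ D'.hF₂).1.trans hw₂) ((hpin t₃ D'.hF₃).1.trans hw₃),
    st_twin_merge W (hcl x₂ fun e he => (hpin e he).2.1) ((hpin t₁ D'.hF₁).2.1.trans hw₁)
      ((hpin t₂ D'.hF₂).2.1.trans hw₂) ((hpin t₃ D'.hF₃).2.1.trans hw₃),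
    st_twin_merge W (hcl x₃ fun e he => (hpin e he).2.2) ((hpin t₁ D'.hF₁).2.2.trans hw₁)
      ((hpin t₂ D'.hF₂).2.2.trans hw₂) ((hpin t₃ D'.hF₃).2.2.trans hw₃)]

/-- **The triangle base is a typed count of the twin-star graph**: with `s₃` and `t₁` pinned open
and `s₂`, `t₂`, `t₃` of type `1`, `N(G⁺) = B(△₁)`. -/
theorem Btriangle_eq_typedCount_twin (W : TwinStar ends o a₁ a₂ a₃ b s₁ s₂ s₃ t₁ t₂ t₃ y y' u₁ u₂
  u₃)
    (D : StarData ends o a₁ a₂ a₃ b s₁ s₂ s₃ y u₁ u₂ u₃ F₀ z₀)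
    (D' : StarData ends o a₁ a₂ a₃ b t₁ t₂ t₃ y' u₁ u₂ u₃ F₀ z₀) (τ : E → ℕ)
    (hz₁ : z₀ s₁ = false) (hz₂ : z₀ s₂ = false) (hz₃ : z₀ s₃ = false) (hw₁ : z₀ t₁ = false)
    (hw₂ : z₀ t₂ = false) (hw₃ : z₀ t₃ = false) :
    typedCount (insert s₂ (insert t₂ (insert t₃ F₀)))
        (Function.update (Function.update z₀ s₃ true) t₁ true)
        (Function.update (Function.update (Function.update τ t₃ 1) t₂ 1) s₂ 1)
        (K3 ends o a₁ a₂ a₃ b : Config E → Config E → Config E → R) =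
      Btriangle ends o a₁ a₂ a₃ b s₁ s₂ s₃ F₀ z₀ τ := by
  have hF₂ : s₂ ∉ insert t₂ (insert t₃ F₀) := by
    simp only [Finset.mem_insert, not_or]; exact ⟨W.T.c22, W.T.c23, D.hF₂⟩
  have hG₂ : t₂ ∉ insert t₃ F₀ := by
    simp only [Finset.mem_insert, not_or]; exact ⟨W.T.g23, D'.hF₂⟩
  rw [typedCount_split (insert s₂ (insert t₂ (insert t₃ F₀))) s₂ (Finset.mem_insert_self _ _)]
  simp only [Function.update_self, Finset.erase_insert hF₂, sum_bool3_one]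
  simp only [typedCount_split (insert t₂ (insert t₃ F₀)) t₂ (Finset.mem_insert_self _ _),
    Function.update_of_ne W.T.c22.symm, Function.update_self, Finset.erase_insert hG₂,
    sum_bool3_one]
  simp only [typedCount_split (insert t₃ F₀) t₃ (Finset.mem_insert_self _ _),
    Function.update_of_ne W.T.c23.symm, Function.update_of_ne W.T.g23.symm, Function.update_self,
    Finset.erase_insert D'.hF₃, sum_bool3_one]
  simp only [twin_term_eq_patCount W D D' τ hz₁ hz₂ hz₃ hw₁ hw₂ hw₃]
  unfold Btriangle Bindep3
  simp only [sum_placements]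
  ring

end Count

section Corollary

variable {V : Type*} {E : Type*} [Fintype E] [DecidableEq E] {R : Type*} [Field R] [LinearOrder R]
  {ends : E → Sym2 V} {o a₁ a₂ a₃ b : V} {s₁ s₂ s₃ t₁ t₂ t₃ : E} {y y' u₁ u₂ u₃ : V}
  {F₀ : Finset E} {z₀ : Config E}

/-- **TvT on the twin-star graph**: `B(T₁) ≤ B(△₁)` iff the triple base is at most the typed count
of `G⁺` with `s₃`, `t₁` open and `s₂`, `t₂`, `t₃` of type `1`. -/
theorem tvT_iff_twin (W : TwinStar ends o a₁ a₂ a₃ b s₁ s₂ s₃ t₁ t₂ t₃ y y' u₁ u₂ u₃)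
    (D : StarData ends o a₁ a₂ a₃ b s₁ s₂ s₃ y u₁ u₂ u₃ F₀ z₀)
    (D' : StarData ends o a₁ a₂ a₃ b t₁ t₂ t₃ y' u₁ u₂ u₃ F₀ z₀) (τ : E → ℕ)
    (hz₁ : z₀ s₁ = false) (hz₂ : z₀ s₂ = false) (hz₃ : z₀ s₃ = false) (hw₁ : z₀ t₁ = false)
    (hw₂ : z₀ t₂ = false) (hw₃ : z₀ t₃ = false) :
    TvT (R := R) ends o a₁ a₂ a₃ b s₁ s₂ s₃ F₀ z₀ τ ↔
      Bone (R := R) ends o a₁ a₂ a₃ b s₁ s₂ s₃ F₀ z₀ τ (true, true, true) ≤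
        typedCount (insert s₂ (insert t₂ (insert t₃ F₀)))
          (Function.update (Function.update z₀ s₃ true) t₁ true)
          (Function.update (Function.update (Function.update τ t₃ 1) t₂ 1) s₂ 1)
          (K3 ends o a₁ a₂ a₃ b) := by
  unfold TvT
  rw [Btriangle_eq_typedCount_twin W D D' τ hz₁ hz₂ hz₃ hw₁ hw₂ hw₃]

end Corollary

end StarPattern

end Summit.Ventures.PercRepro2
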